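import Summits.CriticalPhenomena.CardyFormulaZ2.Theses.CardyViaSLE6
import Summits.CriticalPhenomena.CardyFormulaZ2.Theses.CardySelfRefinement
import Summits.CriticalPhenomena.CardyFormulaZ2.Theorems.CardySelfRefinementLagHandOffTightness
import Summits.CriticalPhenomena.CardyFormulaZ2.Theorems.CardySelfRefinementLagHandOffDiscretisable
import Literature.Probability.RandomPlanarGeometry.ConformalRestrictionCovariance
import Literature.Probability.LatticeModels.MedialInterfaceMeasurability

/-!
# Line `existence-symmetry` for crux r2 `ConformalCovarianceOfSubseqLimits`
(stmt-CriticalPhenomena-0763, route CardyViaSLE6) — the typed existence / symmetry decomposition as a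
registered skeleton

Crux-strategist seat, 2026-08-17 (RESTATED deciding-crux re-audit, BC2 redirect).  The crux is cut along
Beffara's dichotomy (arXiv:0708.3908 Prop. 4; `Literature.Barriers.CriticalPhenomena.EmbeddingModulusUniqueness`):

* X₁ `InterfaceLimitExists` — the scaling limit of the bond-ℤ² exploration interface EXISTS, independently of
  the admissible discretisation family (embedding-blind content: the open scale-invariance / uniqueness problem);
* X₂ `LimitFamilyConformalCovariance` — a FULL scaling-limit family of the ℤ² interfaces is conformally covariant
  (the symmetry content: must use the order-4 symmetry / DKKMO rotation invariance and the exact lattice Markov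
  property + locality).

The ROUTE-LEVEL split (children X₁, X₂ as items, r2 DERIVED, glue = the assembly below) is staged in
`Cruxes/ConformalCovarianceOfSubseqLimits/SPLIT.md` (children.json + commands; `route edit --split` is available to a
seat on its final cycle only).  THIS file makes the decomposition LIVE now as a registered line of the parent crux:
five registered stubs — the union of the two child skeletons — and the kernel-checked composition
`ConformalCovarianceOfSubseqLimits_of : stub-sigs → ConformalCovarianceOfSubseqLimits`, passing through the two
pieces as named intermediate theorems (`InterfaceLimitExists_of`, `LimitFamilyConformalCovariance_of`) and the
assembly `conformalCovarianceOfSubseqLimits_of_subs : X₁ → X₂ → r2` (all three REAL proofs).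

Stubs (sorries ONLY here):
* `stub_familyIndependence` (L) and `stub_sequenceIndependence` (XL, uniqueness) ⇒ X₁, using the tree THEOREMS
  tightness-for-every-family (`HittingTournament.stub_tournamentTransfer_tightness`, route CardySelfRefinement) and
  measurability (`measurable_of_medialExploration`), Prokhorov along the mesh and `tendsto_of_subseq_tendsto`;
* `stub_similarityCovariance` (XL), `stub_localMarkov` (XL), `stub_upgrade` (open, HARDEST) ⇒ X₂; the hardest stub
  is PROVED below to follow from the sister crux `CardySelfRefinement.SymmetryUpgradeR` (stmt-17239, live lead).

Side results proved here: `interfaceTightness : CardyViaSLE6.InterfaceTightness` (the route's support item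
stmt-CriticalPhenomena-14294, sorry-free — a prover may land it) and `stub_upgrade_of_symmetryUpgradeR`.
-/

noncomputable section

open Filter Topology MeasureTheory Set
open scoped BoundedContinuousFunction unitInterval
open Literature.Probability.RandomPlanarGeometry Literature.Probability.LatticeModels
open Literature.Probability.Percolation (bondPercolation half BondConfig)
open Summit.CriticalPhenomena.CardyFormulaZ2.Theses.CardyViaSLE6

namespace Summit.CriticalPhenomena.CardyFormulaZ2.Cruxes.ConformalCovarianceOfSubseqLimits.ExistenceSymmetry

/-! ## Piece X₁ — `InterfaceLimitExists` and its skeleton -/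


/-- The piece X₁ (verbatim the child statement `InterfaceLimitExists` of the split of
`ConformalCovarianceOfSubseqLimits`; inlined here until the gate writes the route decl). -/
def InterfaceLimitExists : Prop :=
  ∀ D : Literature.Probability.RandomPlanarGeometry.DobrushinDomain, ∃ μ : MeasureTheory.Measure (Literature.Probability.RandomPlanarGeometry.CurveClass ℂ), MeasureTheory.IsProbabilityMeasure μ ∧ ∀ (E : ℝ → Literature.Probability.LatticeModels.DiscreteDobrushin), Literature.Probability.LatticeModels.ZdDiscretisationFamily D E → ∀ f : BoundedContinuousFunction (Literature.Probability.RandomPlanarGeometry.CurveClass ℂ) ℝ, Filter.Tendsto (fun δ => ∫ ω, f (Literature.Probability.Percolation.bondInterfaceIn D (E δ) ω) ∂(Literature.Probability.Percolation.bondPercolation (Literature.Probability.LatticeModels.zdGraph 2) Literature.Probability.Percolation.half)) (nhdsWithin 0 (Set.Ioi 0)) (nhds (∫ γ, f γ ∂μ))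

/-! ### Registered stubs -/

/-- STUB (L) — **family independence along a common mesh sequence.** Two admissible
ℤ²-discretisation families `E, E'` of the same Dobrushin domain, run along the same meshes
`s n → 0⁺`, have the same subsequential interface limit.  Content: the interface law is insensitive
to mesh-scale modifications of the wired / dual-wired arcs and of the discrete marks (RSW half-plane
2- and 3-arm bounds at boundary points; Camia–Newman 2006 §5, Nolin 2008 Thm 23).  Why it might
fail: wild prime ends / fjords of `∂Ω` where the two families' arcs differ at many scales. -/
theorem stub_familyIndependence :
    ∀ (D : DobrushinDomain) (E E' : ℝ → DiscreteDobrushin),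
      ZdDiscretisationFamily D E → ZdDiscretisationFamily D E' →
      ∀ s : ℕ → ℝ, Tendsto s atTop (𝓝[>] (0 : ℝ)) →
      ∀ (μ μ' : Measure (CurveClass ℂ)) [IsProbabilityMeasure μ] [IsProbabilityMeasure μ'],
        (∀ f : CurveClass ℂ →ᵇ ℝ, Tendsto (fun n => ∫ ω, f (Literature.Probability.Percolation.bondInterfaceIn D (E (s n)) ω)
          ∂(bondPercolation (zdGraph 2) half)) atTop (𝓝 (∫ γ, f γ ∂μ))) →
        (∀ f : CurveClass ℂ →ᵇ ℝ, Tendsto (fun n => ∫ ω, f (Literature.Probability.Percolation.bondInterfaceIn D (E' (s n)) ω)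
          ∂(bondPercolation (zdGraph 2) half)) atTop (𝓝 (∫ γ, f γ ∂μ'))) →
        μ = μ' := by
  sorry

/-- STUB (XL, the hard one) — **sequence independence for one family** (scale invariance /
uniqueness of subsequential limits on ℤ²): for one admissible family `E` of `D`, subsequential
interface limits along any two mesh sequences coincide.  Engines: CardySelfRefinement's Russo drift
(`ScaleInvariantLimits`, `LagsToInvariance`, `TwoLagsAllLags`: invariance of quad-crossing limits
under the lags 2 and 3, hence all dilations) transferred to interfaces (`LagHandOff`), or an RG /
coupling argument.  Why it might fail: an RG limit cycle (log-periodic dependence on `log δ`). -/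
theorem stub_sequenceIndependence :
    ∀ (D : DobrushinDomain) (E : ℝ → DiscreteDobrushin), ZdDiscretisationFamily D E →
      ∀ s s' : ℕ → ℝ, Tendsto s atTop (𝓝[>] (0 : ℝ)) → Tendsto s' atTop (𝓝[>] (0 : ℝ)) →
      ∀ (μ μ' : Measure (CurveClass ℂ)) [IsProbabilityMeasure μ] [IsProbabilityMeasure μ'],
        (∀ f : CurveClass ℂ →ᵇ ℝ, Tendsto (fun n => ∫ ω, f (Literature.Probability.Percolation.bondInterfaceIn D (E (s n)) ω)
          ∂(bondPercolation (zdGraph 2) half)) atTop (𝓝 (∫ γ, f γ ∂μ))) →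
        (∀ f : CurveClass ℂ →ᵇ ℝ, Tendsto (fun n => ∫ ω, f (Literature.Probability.Percolation.bondInterfaceIn D (E (s' n)) ω)
          ∂(bondPercolation (zdGraph 2) half)) atTop (𝓝 (∫ γ, f γ ∂μ'))) →
        μ = μ' := by
  sorry

/-! ### Tree inputs (proved): measurability and tightness of the interface for every family -/

/-- The interface map of any discrete Dobrushin data is measurable (a function of the medial
exploration; `measurable_of_medialExploration`). -/
theorem measurable_bondInterfaceIn (D : DobrushinDomain) (E : DiscreteDobrushin) :
    Measurable (Literature.Probability.Percolation.bondInterfaceIn D E) :=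
  measurable_of_medialExploration E fun ω ω' h => by
    simp only [Literature.Probability.Percolation.bondInterfaceIn, medialExplorationCurve_congr h]

/-- Eventual a.e.-measurability along the mesh (in fact for every mesh and every law). -/
theorem eventually_aemeasurable_bondInterfaceIn (D : DobrushinDomain) (E : ℝ → DiscreteDobrushin) :
    ∀ᶠ δ in 𝓝[>] (0 : ℝ),
      AEMeasurable (Literature.Probability.Percolation.bondInterfaceIn D (E δ)) (bondPercolation (zdGraph 2) half) :=
  Eventually.of_forall fun δ => (measurable_bondInterfaceIn D (E δ)).aemeasurable

/-- Aizenman–Burchard tightness along the mesh for EVERY admissible family (tree theorem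
`stub_tournamentTransfer_tightness` of route CardySelfRefinement + the bridge
`isTightAlongMesh_of_isTightMeasureSet_image`).  This is route CardyViaSLE6's support item
`InterfaceTightness`, proved. -/
theorem isTightAlongMesh_bondInterfaceIn (D : DobrushinDomain) (E : ℝ → DiscreteDobrushin)
    (hE : ZdDiscretisationFamily D E) :
    IsTightAlongMesh (Ωδ := fun _ => BondConfig (Site 2)) (fun δ => Literature.Probability.Percolation.bondInterfaceIn D (E δ))
      (fun _ => bondPercolation (zdGraph 2) half) := by
  obtain ⟨δ₀, hδ₀, h⟩ :=
    Summit.CriticalPhenomena.CardyFormulaZ2.Cruxes.LagHandOff.HittingTournament.stub_tournamentTransfer_tightness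
      D E hE
  exact isTightAlongMesh_of_isTightMeasureSet_image (Ωδ := fun _ => BondConfig (Site 2))
    (Y := fun δ => Literature.Probability.Percolation.bondInterfaceIn D (E δ)) (P := fun _ => bondPercolation (zdGraph 2) half)
    (eventually_aemeasurable_bondInterfaceIn D E) hδ₀ h

/-- The support item `InterfaceTightness` of route CardyViaSLE6, by name. -/
theorem interfaceTightness : InterfaceTightness :=
  fun D E hE => isTightAlongMesh_bondInterfaceIn D E hE

/-! ### Composition -/

/-- **Composition (real proof).** Family independence + sequence independence ⇒ the scaling limit
exists: Prokhorov along the mesh gives limit points for every admissible family along every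
sequence; the two stubs identify them all with one reference limit; the subsequence principle on
the countably generated filter `𝓝[>] 0` upgrades this to convergence along the filter. -/
theorem InterfaceLimitExists_of
    (hF : ∀ (D : DobrushinDomain) (E E' : ℝ → DiscreteDobrushin),
      ZdDiscretisationFamily D E → ZdDiscretisationFamily D E' →
      ∀ s : ℕ → ℝ, Tendsto s atTop (𝓝[>] (0 : ℝ)) →
      ∀ (μ μ' : Measure (CurveClass ℂ)) [IsProbabilityMeasure μ] [IsProbabilityMeasure μ'],
        (∀ f : CurveClass ℂ →ᵇ ℝ, Tendsto (fun n => ∫ ω, f (Literature.Probability.Percolation.bondInterfaceIn D (E (s n)) ω)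
          ∂(bondPercolation (zdGraph 2) half)) atTop (𝓝 (∫ γ, f γ ∂μ))) →
        (∀ f : CurveClass ℂ →ᵇ ℝ, Tendsto (fun n => ∫ ω, f (Literature.Probability.Percolation.bondInterfaceIn D (E' (s n)) ω)
          ∂(bondPercolation (zdGraph 2) half)) atTop (𝓝 (∫ γ, f γ ∂μ'))) →
        μ = μ')
    (hS : ∀ (D : DobrushinDomain) (E : ℝ → DiscreteDobrushin), ZdDiscretisationFamily D E →
      ∀ s s' : ℕ → ℝ, Tendsto s atTop (𝓝[>] (0 : ℝ)) → Tendsto s' atTop (𝓝[>] (0 : ℝ)) →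
      ∀ (μ μ' : Measure (CurveClass ℂ)) [IsProbabilityMeasure μ] [IsProbabilityMeasure μ'],
        (∀ f : CurveClass ℂ →ᵇ ℝ, Tendsto (fun n => ∫ ω, f (Literature.Probability.Percolation.bondInterfaceIn D (E (s n)) ω)
          ∂(bondPercolation (zdGraph 2) half)) atTop (𝓝 (∫ γ, f γ ∂μ))) →
        (∀ f : CurveClass ℂ →ᵇ ℝ, Tendsto (fun n => ∫ ω, f (Literature.Probability.Percolation.bondInterfaceIn D (E (s' n)) ω)
          ∂(bondPercolation (zdGraph 2) half)) atTop (𝓝 (∫ γ, f γ ∂μ'))) →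
        μ = μ') :
    InterfaceLimitExists := by
  intro D
  classical
  by_cases hex : ∃ E₀ : ℝ → DiscreteDobrushin, ZdDiscretisationFamily D E₀
  · obtain ⟨E₀, hE₀⟩ := hex
    -- reference limit along the meshes 1/(n+1)
    have hs₀ : Tendsto (fun n : ℕ => 1 / ((n : ℝ) + 1)) atTop (𝓝[>] (0 : ℝ)) :=
      tendsto_nhdsWithin_iff.2 ⟨tendsto_one_div_add_atTop_nhds_zero_nat,
        Eventually.of_forall fun n => Set.mem_Ioi.2 Nat.one_div_pos_of_nat⟩
    obtain ⟨φ, μ, hφ, hμ, hlim₀⟩ := (isTightAlongMesh_bondInterfaceIn D E₀ hE₀).exists_subseq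
      (eventually_aemeasurable_bondInterfaceIn D E₀) hs₀
    refine ⟨μ, hμ, fun E hE f => ?_⟩
    refine tendsto_of_subseq_tendsto fun ns hns => ?_
    -- a limit point of the `E`-interfaces along a subsequence of `ns`
    obtain ⟨ms, ν, hms, hν, hlimν⟩ := (isTightAlongMesh_bondInterfaceIn D E hE).exists_subseq
      (eventually_aemeasurable_bondInterfaceIn D E) hns
    -- a limit point of the `E₀`-interfaces along a further subsequence
    have hns' : Tendsto (ns ∘ ms) atTop (𝓝[>] (0 : ℝ)) := hns.comp hms.tendsto_atTop
    obtain ⟨ms', ν₀, hms', hν₀, hlimν₀⟩ :=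
      (isTightAlongMesh_bondInterfaceIn D E₀ hE₀).exists_subseq
        (eventually_aemeasurable_bondInterfaceIn D E₀) hns'
    haveI := hμ; haveI := hν; haveI := hν₀
    -- sequence independence for `E₀`: the reference limit is `ν₀`
    have h1 : μ = ν₀ := hS D E₀ hE₀ (fun n => 1 / ((φ n : ℝ) + 1)) ((ns ∘ ms) ∘ ms')
      (hs₀.comp hφ.tendsto_atTop) (hns'.comp hms'.tendsto_atTop) μ ν₀ hlim₀ hlimν₀
    -- family independence along the common sequence: `ν₀ = ν`
    have h2 : ν₀ = ν := hF D E₀ E hE₀ hE ((ns ∘ ms) ∘ ms') (hns'.comp hms'.tendsto_atTop) ν₀ ν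
      hlimν₀ (fun g => (hlimν g).comp hms'.tendsto_atTop)
    refine ⟨ms, ?_⟩
    have h := hlimν f
    rw [← h2, ← h1] at h
    exact h
  · refine ⟨Measure.dirac (CurveClass.mk (Curve.const 0)), inferInstance, fun E hE => ?_⟩
    exact (hex ⟨E, hE⟩).elim

/-- The piece, from the registered stubs. -/
theorem interfaceLimitExists : InterfaceLimitExists :=
  InterfaceLimitExists_of stub_familyIndependence stub_sequenceIndependence

/-! ## Piece X₂ — `LimitFamilyConformalCovariance` and its skeleton -/


/-- The piece X₂ (verbatim the child statement `LimitFamilyConformalCovariance` of the split of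
`ConformalCovarianceOfSubseqLimits`; inlined here until the gate writes the route decl). -/
def LimitFamilyConformalCovariance : Prop :=
  ∀ P : Literature.Probability.RandomPlanarGeometry.ChordalFamily, (∀ D, MeasureTheory.IsProbabilityMeasure (P D)) → (∀ (D : Literature.Probability.RandomPlanarGeometry.DobrushinDomain) (E : ℝ → Literature.Probability.LatticeModels.DiscreteDobrushin), Literature.Probability.LatticeModels.ZdDiscretisationFamily D E → ∀ f : BoundedContinuousFunction (Literature.Probability.RandomPlanarGeometry.CurveClass ℂ) ℝ, Filter.Tendsto (fun δ => ∫ ω, f (Literature.Probability.Percolation.bondInterfaceIn D (E δ) ω) ∂(Literature.Probability.Percolation.bondPercolation (Literature.Probability.LatticeModels.zdGraph 2) Literature.Probability.Percolation.half)) (nhdsWithin 0 (Set.Ioi 0)) (nhds (∫ γ, f γ ∂(P D)))) → P.IsConformallyCovariant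

/-- `P` is the FULL scaling limit of the bond-ℤ² interfaces (the hypothesis of the piece). -/
def IsFullLimit (P : ChordalFamily) : Prop :=
  ∀ (D : DobrushinDomain) (E : ℝ → DiscreteDobrushin), ZdDiscretisationFamily D E →
    ∀ f : CurveClass ℂ →ᵇ ℝ, Tendsto (fun δ => ∫ ω, f (Literature.Probability.Percolation.bondInterfaceIn D (E δ) ω)
      ∂(bondPercolation (zdGraph 2) half)) (𝓝[>] 0) (𝓝 (∫ γ, f γ ∂(P D)))

/-- `P`-a.s. no non-trivial sub-arc of the curve lies in `∂D` (verbatim the non-tracing clause of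
`CardySelfRefinement.SymmetryUpgradeR`). -/
def NoBoundaryTracing (P : ChordalFamily) : Prop :=
  ∀ D : DobrushinDomain, ∀ᵐ γ ∂(P D), ∀ c : Curve ℂ, CurveClass.mk c = γ →
    ∀ s t : I, s < t → c '' Set.Icc s t ⊆ frontier D.carrier → (c '' Set.Icc s t).Subsingleton

/-! ### Registered stubs -/

/-- STUB (XL) — **Euclidean covariance of the full limit.** Dilations: exact lattice scaling plus
the E-blindness built into `IsFullLimit` (M, provable now up to the equivariance bookkeeping of
`meshDomain` / `medialExplorationCurve`); translations: exact for lattice vectors, general vectors by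
stability of the limit under `O(δ)` perturbations of the Dobrushin data (RSW half-plane arms, L);
rotations: DKKMO 2020 Thm 1.2 / `Literature.Probability.Percolation.dkkmo_rotation_invariance`
transferred from loops to Dobrushin interfaces (XL; = CardyRotToConf `LoopRotation` + the transfer
inside `LimitFamily`).  Why it might fail: only as typed — the loop→interface transfer at rough
marked prime ends. -/
theorem stub_similarityCovariance :
    ∀ P : ChordalFamily, (∀ D, IsProbabilityMeasure (P D)) → IsFullLimit P →
      P.IsSimilarityCovariant := by
  sorry

/-- STUB (XL) — **the full limit is a non-tracing local Markov chordal family** in the tree's typed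
sense (`IsChordal`, `IsDomainMarkov`, `IsLocal`, `IsTargetIndependent`, `NoBoundaryTracing`): limit
passage of the domain Markov property, locality and target independence, which are EXACT identities
of the lattice exploration at every mesh, plus RSW regularity (half-annulus circuits of both colours:
no boundary tracing, endpoints at the marks).  Shared in content with `CardySelfRefinement.LagHandOff`
(ii) (landed partial work: `Theorems/CardySelfRefinementLagHandOffLimitMarkov`, `…LocalityPassage`,
`…NoTrace*`).  Why it might fail: the set-based `IsMarkovExtension.domain` clause (prime-end caveat)
and slit-domain equicontinuity uniform in `δ` (Camia–Newman 2007 Rem. 7.1). -/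
theorem stub_localMarkov :
    ∀ P : ChordalFamily, (∀ D, IsProbabilityMeasure (P D)) → IsFullLimit P →
      P.IsChordal ∧ P.IsDomainMarkov ∧ P.IsLocal ∧ P.IsTargetIndependent ∧ NoBoundaryTracing P := by
  sorry

/-- STUB (open; the HARDEST) — **Euclidean + Markov + locality ⇒ conformal, for the
percolation-pinned family**: a similarity-covariant, domain-Markov, local, target-independent,
non-tracing chordal family which IS the full scaling limit of the bond-ℤ² interfaces is conformally
covariant.  No model-blind version can hold (`Literature.Barriers.CriticalPhenomena.EmbeddingModulusUniqueness`;
the pure axiomatic form without pinning is REFUTED, negatives stmt-CriticalPhenomena-0698), so a proof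
must use the pinning `IsFullLimit P`.  Implied by the sister crux `CardySelfRefinement.SymmetryUpgradeR`
(`stub_upgrade_of_symmetryUpgradeR` below, proved); weaker than it (covariance, not SLE₆). -/
theorem stub_upgrade :
    ∀ P : ChordalFamily, (∀ D, IsProbabilityMeasure (P D)) → IsFullLimit P →
      IsLocalMarkovChordalFamily P → NoBoundaryTracing P → P.IsConformallyCovariant := by
  sorry

/-! ### Composition (real proof) -/

/-- **Composition.** The three stubs give the piece. -/
theorem LimitFamilyConformalCovariance_of
    (h₁ : ∀ P : ChordalFamily, (∀ D, IsProbabilityMeasure (P D)) → IsFullLimit P →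
      P.IsSimilarityCovariant)
    (h₂ : ∀ P : ChordalFamily, (∀ D, IsProbabilityMeasure (P D)) → IsFullLimit P →
      P.IsChordal ∧ P.IsDomainMarkov ∧ P.IsLocal ∧ P.IsTargetIndependent ∧ NoBoundaryTracing P)
    (h₃ : ∀ P : ChordalFamily, (∀ D, IsProbabilityMeasure (P D)) → IsFullLimit P →
      IsLocalMarkovChordalFamily P → NoBoundaryTracing P → P.IsConformallyCovariant) :
    LimitFamilyConformalCovariance := by
  intro P hprob hlim
  have hfull : IsFullLimit P := hlim
  obtain ⟨hch, hmk, hloc, hti, hnt⟩ := h₂ P hprob hfull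
  exact h₃ P hprob hfull ⟨hch, h₁ P hprob hfull, hmk, hloc, hti⟩ hnt

/-- The piece, from the registered stubs. -/
theorem limitFamilyConformalCovariance : LimitFamilyConformalCovariance :=
  LimitFamilyConformalCovariance_of stub_similarityCovariance stub_localMarkov stub_upgrade

/-! ### The plan on record for the hardest stub: it follows from the sister crux
`CardySelfRefinement.SymmetryUpgradeR` (stmt-CriticalPhenomena-17239) — proved reduction. -/

/-- **`SymmetryUpgradeR ⇒ stub_upgrade`** (so the hardest stub is covered by a live sister line):
a full limit is in particular a sequential limit along `δs n = 1/(n+1)` (clause (iv) of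
`SymmetryUpgradeR`), interfaces are measurable, every Dobrushin domain is admissibly discretisable
(`HittingTournament.stub_discretisable`), so `SymmetryUpgradeR` makes `P D` the chordal SLE₆ law of
every `D`, and a family of SLE₆ laws is conformally covariant
(`ChordalFamily.isConformallyCovariant_of_isSLELaw`, Lawler 2005 §6.1). -/
theorem stub_upgrade_of_symmetryUpgradeR
    (hSU : Summit.CriticalPhenomena.CardyFormulaZ2.Theses.CardySelfRefinement.SymmetryUpgradeR) :
    ∀ P : ChordalFamily, (∀ D, IsProbabilityMeasure (P D)) → IsFullLimit P →
      IsLocalMarkovChordalFamily P → NoBoundaryTracing P → P.IsConformallyCovariant := by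
  intro P _ hfull hLM hNT
  -- the mesh sequence 1/(n+1)
  have hs₀' : Tendsto (fun n : ℕ => 1 / ((n : ℝ) + 1)) atTop (𝓝[>] (0 : ℝ)) :=
    tendsto_nhdsWithin_iff.2 ⟨tendsto_one_div_add_atTop_nhds_zero_nat,
      Eventually.of_forall fun n => Set.mem_Ioi.2 Nat.one_div_pos_of_nat⟩
  have hmeas : ∀ (D : DobrushinDomain) (E : ℝ → DiscreteDobrushin), ZdDiscretisationFamily D E →
      ∀ᶠ δ in 𝓝[>] (0 : ℝ), AEMeasurable (Literature.Probability.Percolation.bondInterfaceIn D (E δ))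
        (bondPercolation (zdGraph 2) half) :=
    fun D E _ => Eventually.of_forall fun δ => (measurable_bondInterfaceIn D (E δ)).aemeasurable
  have hiv : ∃ δs : ℕ → ℝ, (∀ n, 0 < δs n) ∧ Tendsto δs atTop (𝓝 0) ∧
      ∀ (D : DobrushinDomain) (E : ℝ → DiscreteDobrushin), ZdDiscretisationFamily D E →
        ∀ f : CurveClass ℂ →ᵇ ℝ, Tendsto (fun n => ∫ ω,
          f (Literature.Probability.Percolation.bondInterfaceIn D (E (δs n)) ω)
            ∂(bondPercolation (zdGraph 2) half)) atTop (𝓝 (∫ γ, f γ ∂(P D))) :=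
    ⟨fun n => 1 / ((n : ℝ) + 1), fun n => Nat.one_div_pos_of_nat,
      tendsto_one_div_add_atTop_nhds_zero_nat, fun D E hE f => (hfull D E hE f).comp hs₀'⟩
  have hSLE : ∀ D : DobrushinDomain, IsSLELaw 6 D (P D) := fun D => by
    obtain ⟨E, hE⟩ :=
      Summit.CriticalPhenomena.CardyFormulaZ2.Cruxes.LagHandOff.HittingTournament.stub_discretisable D
    exact hSU P hLM hNT hmeas hiv D E hE
  exact ChordalFamily.isConformallyCovariant_of_isSLELaw hSLE

/-! ## The skeleton theorem: the crux BY NAME from the five registered stubs -/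

/-- **THE SKELETON THEOREM.** `ConformalCovarianceOfSubseqLimits` from the registered stubs (sorries only in
`stub_familyIndependence`, `stub_sequenceIndependence`, `stub_similarityCovariance`, `stub_localMarkov`,
`stub_upgrade`), through the two pieces `interfaceLimitExists` (X₁) and `limitFamilyConformalCovariance` (X₂) and
the assembly (the same proof as the sorry-free `conformalCovarianceOfSubseqLimits_of_subs` below). -/
theorem ConformalCovarianceOfSubseqLimits_of : ConformalCovarianceOfSubseqLimits := by
  have h₁ : InterfaceLimitExists := interfaceLimitExists
  have h₂ : LimitFamilyConformalCovariance := limitFamilyConformalCovariance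
  intro D D' g Φ hg0 hg1 hΦ E E' hE hE' s hs μ μ' _ _ hμ hμ' f
  classical
  -- the limit family of X₁
  choose P hP using h₁
  have hprob : ∀ D, IsProbabilityMeasure (P D) := fun D => (hP D).1
  have hlim : ∀ (D : DobrushinDomain) (E : ℝ → DiscreteDobrushin), ZdDiscretisationFamily D E →
      ∀ f : CurveClass ℂ →ᵇ ℝ, Tendsto (fun δ => ∫ ω, f (Literature.Probability.Percolation.bondInterfaceIn D (E δ) ω)
        ∂(bondPercolation (zdGraph 2) half)) (𝓝[>] 0) (𝓝 (∫ γ, f γ ∂(P D))) :=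
    fun D E hE f => (hP D).2 E hE f
  -- X₂: the family is conformally covariant
  have hcov : ChordalFamily.IsConformallyCovariant P := h₂ P hprob hlim
  -- identification of the two subsequential limits with the family along `s`
  have hμP : ∀ f : CurveClass ℂ →ᵇ ℝ, ∫ γ, f γ ∂μ = ∫ γ, f γ ∂(P D) := fun f =>
    tendsto_nhds_unique (hμ f) ((hlim D E hE f).comp hs)
  have hμ'P : ∀ f : CurveClass ℂ →ᵇ ℝ, ∫ γ, f γ ∂μ' = ∫ γ, f γ ∂(P D') := fun f =>
    tendsto_nhds_unique (hμ' f) ((hlim D' E' hE' f).comp hs)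
  -- covariance at `(D, D', g, Φ)`
  have hPD' : P D' = (P D).map (CurveClass.map Φ) := hcov D D' g Φ hg0 hg1 hΦ
  -- the test function `f ∘ CurveClass.map Φ` is bounded continuous
  set fΦ : CurveClass ℂ →ᵇ ℝ := f.compContinuous ⟨CurveClass.map Φ, CurveClass.continuous_map Φ⟩
    with hfΦ
  calc ∫ γ, f γ ∂μ' = ∫ γ, f γ ∂(P D') := hμ'P f
    _ = ∫ γ, f γ ∂((P D).map (CurveClass.map Φ)) := by rw [hPD']
    _ = ∫ γ, f (CurveClass.map Φ γ) ∂(P D) :=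
        integral_map (CurveClass.measurable_map Φ).aemeasurable f.continuous.aestronglyMeasurable
    _ = ∫ γ, fΦ γ ∂(P D) := by simp [hfΦ]
    _ = ∫ γ, fΦ γ ∂μ := (hμP fΦ).symm
    _ = ∫ γ, f (CurveClass.map Φ γ) ∂μ := by simp [hfΦ]

/-! ## Assembly X₁ → X₂ → r2, sorry-free (verbatim the Theorems-ready proof, evidence on stmt-0763) -/

/-- **Assembly of the split (sorry-free):** the two pieces, written out literally, imply the crux.  Choose the X₁
limit law `P D` for every domain; X₂ makes `P` conformally covariant; along the crux's common mesh sequence `s` the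
given subsequential limits `μ, μ'` agree with `P D, P D'` on bounded continuous test functions
(`tendsto_nhds_unique`); then `P D' = (P D).map (CurveClass.map Φ)` and `integral_map`. -/
theorem conformalCovarianceOfSubseqLimits_of_subs
    (h₁ : ∀ D : Literature.Probability.RandomPlanarGeometry.DobrushinDomain, ∃ μ : MeasureTheory.Measure (Literature.Probability.RandomPlanarGeometry.CurveClass ℂ), MeasureTheory.IsProbabilityMeasure μ ∧ ∀ (E : ℝ → Literature.Probability.LatticeModels.DiscreteDobrushin), Literature.Probability.LatticeModels.ZdDiscretisationFamily D E → ∀ f : BoundedContinuousFunction (Literature.Probability.RandomPlanarGeometry.CurveClass ℂ) ℝ, Filter.Tendsto (fun δ => ∫ ω, f (Literature.Probability.Percolation.bondInterfaceIn D (E δ) ω) ∂(Literature.Probability.Percolation.bondPercolation (Literature.Probability.LatticeModels.zdGraph 2) Literature.Probability.Percolation.half)) (nhdsWithin 0 (Set.Ioi 0)) (nhds (∫ γ, f γ ∂μ)))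
    (h₂ : ∀ P : Literature.Probability.RandomPlanarGeometry.ChordalFamily, (∀ D, MeasureTheory.IsProbabilityMeasure (P D)) → (∀ (D : Literature.Probability.RandomPlanarGeometry.DobrushinDomain) (E : ℝ → Literature.Probability.LatticeModels.DiscreteDobrushin), Literature.Probability.LatticeModels.ZdDiscretisationFamily D E → ∀ f : BoundedContinuousFunction (Literature.Probability.RandomPlanarGeometry.CurveClass ℂ) ℝ, Filter.Tendsto (fun δ => ∫ ω, f (Literature.Probability.Percolation.bondInterfaceIn D (E δ) ω) ∂(Literature.Probability.Percolation.bondPercolation (Literature.Probability.LatticeModels.zdGraph 2) Literature.Probability.Percolation.half)) (nhdsWithin 0 (Set.Ioi 0)) (nhds (∫ γ, f γ ∂(P D)))) → P.IsConformallyCovariant) :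
    ConformalCovarianceOfSubseqLimits := by
  intro D D' g Φ hg0 hg1 hΦ E E' hE hE' s hs μ μ' _ _ hμ hμ' f
  classical
  -- the limit family of X₁
  choose P hP using h₁
  have hprob : ∀ D, IsProbabilityMeasure (P D) := fun D => (hP D).1
  have hlim : ∀ (D : DobrushinDomain) (E : ℝ → DiscreteDobrushin), ZdDiscretisationFamily D E →
      ∀ f : CurveClass ℂ →ᵇ ℝ, Tendsto (fun δ => ∫ ω, f (Literature.Probability.Percolation.bondInterfaceIn D (E δ) ω)
        ∂(bondPercolation (zdGraph 2) half)) (𝓝[>] 0) (𝓝 (∫ γ, f γ ∂(P D))) :=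
    fun D E hE f => (hP D).2 E hE f
  -- X₂: the family is conformally covariant
  have hcov : ChordalFamily.IsConformallyCovariant P := h₂ P hprob hlim
  -- identification of the two subsequential limits with the family along `s`
  have hμP : ∀ f : CurveClass ℂ →ᵇ ℝ, ∫ γ, f γ ∂μ = ∫ γ, f γ ∂(P D) := fun f =>
    tendsto_nhds_unique (hμ f) ((hlim D E hE f).comp hs)
  have hμ'P : ∀ f : CurveClass ℂ →ᵇ ℝ, ∫ γ, f γ ∂μ' = ∫ γ, f γ ∂(P D') := fun f =>
    tendsto_nhds_unique (hμ' f) ((hlim D' E' hE' f).comp hs)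
  -- covariance at `(D, D', g, Φ)`
  have hPD' : P D' = (P D).map (CurveClass.map Φ) := hcov D D' g Φ hg0 hg1 hΦ
  -- the test function `f ∘ CurveClass.map Φ` is bounded continuous
  set fΦ : CurveClass ℂ →ᵇ ℝ := f.compContinuous ⟨CurveClass.map Φ, CurveClass.continuous_map Φ⟩
    with hfΦ
  calc ∫ γ, f γ ∂μ' = ∫ γ, f γ ∂(P D') := hμ'P f
    _ = ∫ γ, f γ ∂((P D).map (CurveClass.map Φ)) := by rw [hPD']
    _ = ∫ γ, f (CurveClass.map Φ γ) ∂(P D) :=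
        integral_map (CurveClass.measurable_map Φ).aemeasurable f.continuous.aestronglyMeasurable
    _ = ∫ γ, fΦ γ ∂(P D) := by simp [hfΦ]
    _ = ∫ γ, fΦ γ ∂μ := (hμP fΦ).symm
    _ = ∫ γ, f (CurveClass.map Φ γ) ∂μ := by simp [hfΦ]

end Summit.CriticalPhenomena.CardyFormulaZ2.Cruxes.ConformalCovarianceOfSubseqLimits.ExistenceSymmetry
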